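import Mathlib
import Summits.QuantumFields.YangMills.Theorems.AdjointLoopFanoDirichletKinematic
import Summits.QuantumFields.YangMills.Theorems.FemtoTransferGapGroundState
import Summits.QuantumFields.YangMills.Theorems.LuscherReductionRunningReductionKTPhysSpace
import HarnessLib

/-!
# Crux `TransportFieldFano.AdjointLoopDirichletWeak` ⟨stmt-QuantumFields-23362⟩, line `birth` (planner ym-idea-4 g17): the registered
# stub `stub_kinematicChain` — CLOSED

The birth skeleton of the poly-loss Dirichlet ceiling splits it into the KINEMATIC CHAIN (this stub: the one-step deficit of `FΩ` is bounded
by the weighted temporal plaquette means — verbatim the right side of the tree theorem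
`AdjointLoopFano.deficit_adjLoop_le_weighted_plaquettes`, ✓p735439) and the open `d_x`-weighted plaquette mean.  Two bridges are needed
to reach the registered signature, which quantifies over EVERY `l2`-normalised physical eigenfunction `Ω` at `λ₀` (no sign assumption) and
writes the deficit with `l2 (FΩ) (K_β(FΩ))`:

* `qform = l2 ∘ transferApply` (`qform_eq_l2_transferApply`);
* **sign via Perron–Frobenius–Jentzsch** (`PhysL2.exists_groundState`: a uniformly positive normalised ground state `Ω₊` with a gap
  `θ < λ₀` on `Ω₊^⊥`): any physical eigenfunction `Ω` at `λ₀` equals `cΩ₊` ALMOST EVERYWHERE (`ae_eq_smul_groundState`), so both sides of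
  the chain — which depend on `Ω` only through `dU`- and `dU⊗dV`-integrals and are even in `Ω` — may be evaluated at `|c|·Ω₊ ≥ 0`,
  where the tree theorem applies.

HONEST FRAMING: kinematic bookkeeping; the crux (its `d_x`-weighted plaquette mean) is OPEN; K2a, R2ξ″ and the YM mass gap are NOT proved.
No `sorry`, no new axiom, no new definition.  References: [cite: ReedSimonIV1978, Thm. XIII.1 and XIII.43]; [cite: Luscher1983, §2].
-/

set_option autoImplicit false

noncomputable section

open MeasureTheory Filter Topology Real
open scoped BigOperators
open Literature.MathematicalPhysics.QuantumFieldTheory (GaugeConfig Site Edge gaugeTransform)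
open Literature.MathematicalPhysics.QuantumLattice (secondCountableTopology_su2)

namespace Summit.QuantumFields.YangMills.Theorems.TransportFieldFano

open Summit.QuantumFields.YangMills.Theorems.FemtoTransferGap
open Summit.QuantumFields.YangMills.Theorems.AdjointLoopFano

variable {L : ℕ} [NeZero L]

/-! ## §1 Perron–Frobenius: every physical eigenfunction at `λ₀` is a.e. a multiple of the positive ground state -/

/-- ★ **Simplicity of `λ₀` in a.e. form**: if `Ω₊` is the positive normalised ground state with Jentzsch gap `θ < λ₀` on `Ω₊^⊥`, and `Ω` is
any physical function with `K_βΩ = λ₀Ω`, then `Ω = ⟨Ω,Ω₊⟩·Ω₊` almost everywhere. [cite: ReedSimonIV1978, Thm. XIII.43] -/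
theorem ae_eq_smul_groundState {β : ℝ} {Ω Ωp : GaugeConfig 3 L SU2 → ℝ} (hΩ : IsPhys Ω) (hΩp : IsPhys Ωp)
    (hnp : l2 Ωp Ωp = 1) (heig : transferApply β Ω = topValue su2Rep L β • Ω)
    (heigp : transferApply β Ωp = topValue su2Rep L β • Ωp) {θ : ℝ} (hθ : θ < topValue su2Rep L β)
    (hgap : ∀ ψ : GaugeConfig 3 L SU2 → ℝ, IsPhys ψ → l2 ψ Ωp = 0 → qform su2Rep β ψ ψ ≤ θ * l2 ψ ψ) :
    Ω =ᵐ[configMeasure SU2 L] fun U => l2 Ω Ωp * Ωp U := by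
  set c : ℝ := l2 Ω Ωp with hc
  set w : GaugeConfig 3 L SU2 → ℝ := Ω + (-c) • Ωp with hw_def
  have hw : IsPhys w := hΩ.add (hΩp.smul (-c))
  have hworth : l2 w Ωp = 0 := by
    rw [hw_def, l2_add_left hΩ (hΩp.smul _) hΩp, l2_smul_left, hnp, ← hc]; ring
  have hKw : transferApply β w = topValue su2Rep L β • w := by
    rw [hw_def, transferApply_add β hΩ (hΩp.smul _), transferApply_smul, heig, heigp, smul_add, smul_smul, smul_smul, mul_comm]
  have hq : qform su2Rep β w w = topValue su2Rep L β * l2 w w := by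
    rw [qform_eq_l2_transferApply, hKw, l2_comm, l2_smul_left, l2_comm]
  have hww0 : 0 ≤ l2 w w := l2_self_nonneg w
  have hww : l2 w w = 0 := by
    have h := hgap w hw hworth
    rw [hq] at h
    nlinarith
  -- `l2 w w = ∫ w² = 0` ⇒ `w = 0` a.e.
  have hint : Integrable (fun U => w U * w U) (configMeasure SU2 L) := hw.integrable_mul hw
  have hae : (fun U => w U * w U) =ᵐ[configMeasure SU2 L] 0 := by
    refine (integral_eq_zero_iff_of_nonneg (fun U => mul_self_nonneg (w U)) hint).1 ?_
    have : ∫ U, w U * w U ∂configMeasure SU2 L = l2 w w := rfl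
    rw [this, hww]
  filter_upwards [hae] with U hU
  have hU' : w U = 0 := by simpa using mul_self_eq_zero.1 hU
  have : w U = Ω U + -c * Ωp U := by simp [hw_def]
  rw [this] at hU'
  show Ω U = c * Ωp U
  linarith

/-! ## §2 Both sides of the chain are blind to a.e. modifications and to the sign of `Ω` -/

/-- `transferApply` only sees the a.e. class of its argument. [folklore] -/
theorem transferApply_congr_ae (β : ℝ) {φ φ' : GaugeConfig 3 L SU2 → ℝ} (h : φ =ᵐ[configMeasure SU2 L] φ') :
    transferApply β φ = transferApply β φ' := by
  funext U
  unfold transferApply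
  exact integral_congr_ae (h.mono fun V hV => by simp only [hV])

/-- `l2` only sees the a.e. classes of its arguments. [folklore] -/
theorem l2_congr_ae {a a' b b' : GaugeConfig 3 L SU2 → ℝ} (ha : a =ᵐ[configMeasure SU2 L] a') (hb : b =ᵐ[configMeasure SU2 L] b') :
    l2 a b = l2 a' b' := by
  unfold l2
  exact integral_congr_ae (by filter_upwards [ha, hb] with U h1 h2; rw [h1, h2])

/-! ## §3 The registered stub -/

/-- The registered stub statement `KinematicChainP` of line `birth` of crux ⟨stmt-QuantumFields-23362⟩ (verbatim copy of the skeleton's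
`BirthALD.KinematicChainP`; a registered-stub copy, not a citable fact). -/
abbrev KinematicChainP : Prop :=
    ∀ β : ℝ, 0 ≤ β → ∀ (L : ℕ) [NeZero L], ∀ Ω : Literature.MathematicalPhysics.QuantumFieldTheory.GaugeConfig 3 L SU2 → ℝ, IsPhys Ω → l2 Ω Ω = 1 → transferApply β Ω = topValue su2Rep L β • Ω → let F : Literature.MathematicalPhysics.QuantumFieldTheory.GaugeConfig 3 L SU2 → ℝ := flowLift 0 (fun u : Literature.MathematicalPhysics.QuantumFieldTheory.GaugeConfig 3 1 SU2 => 4 - ((su2Rep (u ((0 : Literature.MathematicalPhysics.QuantumFieldTheory.Site 3 1), (0 : Fin 3)))).trace.re) ^ 2); topValue su2Rep L β * l2 (fun U => F U * Ω U) (fun U => F U * Ω U) - l2 (fun U => F U * Ω U) (transferApply β (fun U => F U * Ω U)) ≤ (2 * (L : ℝ) / Fintype.card (Literature.MathematicalPhysics.QuantumFieldTheory.Site 3 L)) * ∑ x : Literature.MathematicalPhysics.QuantumFieldTheory.Site 3 L, ∑ j ∈ Finset.range L, ∫ p, Ω p.1 * transferKernel su2Rep β p.1 p.2 * Ω p.2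 * ((flowLiftAt x 0 (fun u : Literature.MathematicalPhysics.QuantumFieldTheory.GaugeConfig 3 1 SU2 => 4 - ((su2Rep (u ((0 : Literature.MathematicalPhysics.QuantumFieldTheory.Site 3 1), (0 : Fin 3)))).trace.re) ^ 2) p.1 + flowLiftAt x 0 (fun u : Literature.MathematicalPhysics.QuantumFieldTheory.GaugeConfig 3 1 SU2 => 4 - ((su2Rep (u ((0 : Literature.MathematicalPhysics.QuantumFieldTheory.Site 3 1), (0 : Fin 3)))).trace.re) ^ 2) p.2) * (4 - 2 * (((p.1 ((fun z : Literature.MathematicalPhysics.QuantumFieldTheory.Site 3 L => z.shift 0)^[j] x, 0) * (p.2 ((fun z : Literature.MathematicalPhysics.QuantumFieldTheory.Site 3 L => z.shift 0)^[j] x, 0))⁻¹ : SU2) : Matrix (Fin 2) (Fin 2) ℂ).trace.re))) ∂(configMeasure SU2 L).prod (configMeasure SU2 L)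

/-- ★★ **`stub_kinematicChain`** (registered stub of the birth skeleton of crux ⟨stmt-QuantumFields-23362⟩, signature `KinematicChainP`
verbatim): for `β ≥ 0` and every `l2`-normalised physical eigenfunction `Ω` at `λ₀`, the one-step deficit of `FΩ` is at most
`(2L/|Λ|) Σ_x Σ_{j<L} ∫∫ Ω(U)K_β(U,V)Ω(V)(d_x(U)+d_x(V))(4 − 2Re tr U_{x_j}V_{x_j}⁻¹)`. [cite: ReedSimonIV1978, Thm. XIII.1] [cite: Luscher1983, §2] -/
theorem stub_kinematicChain : KinematicChainP := by
  intro β hβ L _ Ω hΩ hn heig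
  dsimp only
  -- the positive ground state and the a.e. identification `Ω = c Ω₊`
  obtain ⟨Ωp, θ, cp, hΩp, hcp, hΩpge, hnp, heigp, -, hθ, hgap⟩ := PhysL2.exists_groundState (L := L) β
  set c : ℝ := l2 Ω Ωp with hc
  have hae : Ω =ᵐ[configMeasure SU2 L] fun U => c * Ωp U := ae_eq_smul_groundState hΩ hΩp hnp heig heigp hθ hgap
  -- the non-negative representative `Ω'' = |c| Ω₊` and the sign `σ`
  set σ : ℝ := if 0 ≤ c then 1 else -1 with hσ
  have hσ2 : σ * σ = 1 := by rw [hσ]; split_ifs <;> norm_num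
  have hσc : σ * |c| = c := by
    rw [hσ]; split_ifs with h
    · rw [abs_of_nonneg h, one_mul]
    · rw [abs_of_neg (not_le.mp h)]; ring
  set Ω'' : GaugeConfig 3 L SU2 → ℝ := fun U => |c| * Ωp U with hΩ''_def
  have hΩ'' : IsPhys Ω'' := by
    have h := hΩp.smul |c|
    have e : (|c| • Ωp) = Ω'' := by funext U; simp [hΩ''_def]
    rw [← e]; exact h
  have hΩ''nn : ∀ U, 0 ≤ Ω'' U := fun U => mul_nonneg (abs_nonneg c) (hcp.le.trans (hΩpge U))
  have heig'' : transferApply β Ω'' = topValue su2Rep L β • Ω'' := by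
    have e : Ω'' = |c| • Ωp := by funext U; simp [hΩ''_def]
    rw [e, transferApply_smul, heigp, smul_smul, smul_smul, mul_comm]
  have haeσ : Ω =ᵐ[configMeasure SU2 L] fun U => σ * Ω'' U := by
    filter_upwards [hae] with U hU
    rw [hU, hΩ''_def]; dsimp only; rw [← mul_assoc, hσc]
  -- the tree's kinematic chain for `Ω''`
  have hkin := deficit_adjLoop_le_weighted_plaquettes (L := L) hβ hΩ'' hΩ''nn heig''
  -- abbreviation for `F`
  set F : GaugeConfig 3 L SU2 → ℝ :=
    flowLift 0 (fun u : GaugeConfig 3 1 SU2 => 4 - ((su2Rep (u ((0 : Site 3 1), (0 : Fin 3)))).trace.re) ^ 2) with hF_def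
  -- transport of the left side
  have hφae : (fun U => F U * Ω U) =ᵐ[configMeasure SU2 L] fun U => σ * (F U * Ω'' U) := by
    filter_upwards [haeσ] with U hU; rw [hU]; ring
  have hKφ : transferApply β (fun U => F U * Ω U) = σ • transferApply β (fun U => F U * Ω'' U) := by
    rw [transferApply_congr_ae β hφae, ← transferApply_smul]; rfl
  have hL1 : l2 (fun U => F U * Ω U) (fun U => F U * Ω U) = l2 (fun U => F U * Ω'' U) (fun U => F U * Ω'' U) := by
    rw [l2_congr_ae hφae hφae]
    unfold l2
    refine integral_congr_ae (ae_of_all _ fun U => ?_)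
    dsimp only
    have : σ * (F U * Ω'' U) * (σ * (F U * Ω'' U)) = σ * σ * (F U * Ω'' U * (F U * Ω'' U)) := by ring
    rw [this, hσ2, one_mul]
  have hL2 : l2 (fun U => F U * Ω U) (transferApply β (fun U => F U * Ω U)) =
      l2 (fun U => F U * Ω'' U) (transferApply β (fun U => F U * Ω'' U)) := by
    rw [hKφ, l2_congr_ae hφae (ae_eq_refl _)]
    unfold l2
    refine integral_congr_ae (ae_of_all _ fun U => ?_)
    dsimp only
    simp only [Pi.smul_apply, smul_eq_mul]
    have : σ * (F U * Ω'' U) * (σ * transferApply β (fun U => F U * Ω'' U) U) =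
        σ * σ * (F U * Ω'' U * transferApply β (fun U => F U * Ω'' U) U) := by ring
    rw [this, hσ2, one_mul]
  have hLHS : topValue su2Rep L β * l2 (fun U => F U * Ω U) (fun U => F U * Ω U) -
      l2 (fun U => F U * Ω U) (transferApply β (fun U => F U * Ω U)) =
      topValue su2Rep L β * l2 (fun U => F U * Ω'' U) (fun U => F U * Ω'' U) -
        qform su2Rep β (fun U => F U * Ω'' U) (fun U => F U * Ω'' U) := by
    rw [hL1, hL2, qform_eq_l2_transferApply]
  -- transport of the right side (product measure)
  have hfst : (fun p : GaugeConfig 3 L SU2 × GaugeConfig 3 L SU2 => Ω p.1) =ᵐ[(configMeasure SU2 L).prod (configMeasure SU2 L)]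
      fun p => σ * Ω'' p.1 :=
    (Measure.quasiMeasurePreserving_fst (μ := configMeasure SU2 L) (ν := configMeasure SU2 L)).ae_eq haeσ
  have hsnd : (fun p : GaugeConfig 3 L SU2 × GaugeConfig 3 L SU2 => Ω p.2) =ᵐ[(configMeasure SU2 L).prod (configMeasure SU2 L)]
      fun p => σ * Ω'' p.2 :=
    (Measure.quasiMeasurePreserving_snd (μ := configMeasure SU2 L) (ν := configMeasure SU2 L)).ae_eq haeσ
  have hRHS : ∀ (G : GaugeConfig 3 L SU2 × GaugeConfig 3 L SU2 → ℝ),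
      ∫ p, Ω p.1 * transferKernel su2Rep β p.1 p.2 * Ω p.2 * G p ∂(configMeasure SU2 L).prod (configMeasure SU2 L) =
        ∫ p, Ω'' p.1 * transferKernel su2Rep β p.1 p.2 * Ω'' p.2 * G p ∂(configMeasure SU2 L).prod (configMeasure SU2 L) := by
    intro G
    refine integral_congr_ae ?_
    filter_upwards [hfst, hsnd] with p h1 h2
    have h1' : Ω p.1 = σ * Ω'' p.1 := h1
    have h2' : Ω p.2 = σ * Ω'' p.2 := h2
    rw [h1', h2']
    have : σ * Ω'' p.1 * transferKernel su2Rep β p.1 p.2 * (σ * Ω'' p.2) * G p =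
        σ * σ * (Ω'' p.1 * transferKernel su2Rep β p.1 p.2 * Ω'' p.2 * G p) := by ring
    rw [this, hσ2, one_mul]
  rw [hLHS]
  simp only [hRHS]
  exact hkin

end Summit.QuantumFields.YangMills.Theorems.TransportFieldFano

end
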